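import Summits.Ventures.CertifiedArithmetic.Expansions.Orient3dStageBExpansion
import Summits.Ventures.CertifiedArithmetic.Expansions.Orient3dStageBBounds
import Summits.Ventures.CertifiedArithmetic.Expansions.Orient3dStageBMargins
import Literature.ComputerArithmetic.Shewchuk1997.Orient3dStageA
import Mathlib.Tactic.Linarith
import Mathlib.Tactic.Positivity
import Mathlib.Tactic.Ring
import Mathlib.Tactic.NormNum

/-!
# Stage B of ORIENT3D, the assembly: the stage-B test of `orient3dadapt` is sound

NEW WORK in the sense of this development (algorithm: Shewchuk, `predicates.c` `orient3dadapt` and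
Table 3; the model over `ℚ`, the statement of correctness and its proof are ours; nothing here is
cited anywhere as a literature fact; the coefficient certified is OURS, `(3 + 32ε)ε`, not the
table's `(3 + 28ε)ε` — see `Orient3dStageBMargins.lean` for why and for what that does NOT claim).

THE MODEL (`orient3dStageB`).  After the stage-A filter (`orient3dStageA`,
`Literature/…/Shewchuk1997/Orient3dStageA.lean`) falls through, `orient3dadapt` forms the nine
differences `adx = a_x ⊖ d_x, …, cdz = c_z ⊖ d_z`, the exact expansion `fin1` of the determinant of
these COMPUTED differences (`orient3dB`, `Orient3dStageBExpansion.lean`: a W-expansion of ≤ 24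
floats with sum `B = orient3dDetB`), `det = estimate(fin1)`, `errbound = K ⊗ permanent` with the
`permanent` inherited from stage A (`orient3dPermanent`, the same floating-point expression as in
`orient3dStageA`), and returns `det` iff `det ≥ errbound` or `−det ≥ errbound`; otherwise it goes
on to stages C–D.  As everywhere in this library: exact model over `ℚ`, an abstract
round-to-nearest `fl` into `F(p, emin)`, an abstract two-product `tp`, no overflow.

THE RESULT, relative to ONE explicit hypothesis on `estimate` (`hest3`): the relative error bound
of Shewchuk's `estimate` on W-expansions of floats of `F(p, emin)`, `|estimate(e) − Σe| ≤ 3ε|Σe|`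
— exactly the conclusion of `abs_estimate_sub_sum_le_of_isWeakExpansion`
(`EstimateRelativeError.lean`, this library, in review at the time of writing; it holds for every
round-to-nearest with `p ≥ 2`).  It is carried here as a HYPOTHESIS of each theorem, never as a
fact, so that this file depends only on landed modules; the unconditional corollaries are
one-liners once that file is in the tree (`Orient3dStageBCorrect.lean`, staged with it).
* **`orient3dStageB_correct_of_estimate`** — for `p ≥ 7`, `fl` a round-to-nearest with the
  `RoundoffBelow 2` property (e.g. ties-to-even) satisfying the `estimate` bound,
  `K = o3derrboundB32 p = (3 + 32ε)ε`, the twelve coordinates in a format `F(p, e₀)` with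
  `emin ≤ e₀` and `emin + 2p ≤ 3e₀` (stage A's hypotheses: every rounding of the permanent chain is
  exact or of a normal number, and no partial product underflows), and `tp` error-free on
  `F(p, e₀)²` and on `F(p, 2e₀) × F(p, e₀)`: **if stage B returns `d`, then `d > 0 ↔ (7) > 0` and
  `d < 0 ↔ (7) < 0`** for the exact determinant `orient3dDet` of the input points — `d ≠ 0` and
  the returned sign is the true orientation.
  Proof = the landed ingredients and nothing else: `orient3dB_spec` (the expansion is a
  W-expansion of floats with `Σ = B`, `Orient3dStageBExpansion.lean`), the hypothesis
  (`|det − B| ≤ 3ε|B|`), the margin `o3derrboundB32_margin` (`(1 + 3ε)(3ε + 6ε² + 4ε³ + ε⁴)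
  < (1 − ε)⁵K` for `ε ≤ 1/128`, `Orient3dStageBMargins.lean`) and the rational analysis
  `orient3d_stageB_sign_of_bounds` (`Orient3dStageBBounds.lean`) fed with the roundoff facts of the
  floating-point operations (the grids `2^e₀ ℤ`, `2^2e₀ ℤ`, `2^3e₀ ℤ`, `2^(3e₀ − 2p) ℤ` exactly as
  in the stage-A proof `orient3dStageA_correct`).
* `orient3dStageB_fma_correct_of_estimate` / `orient3dStageB_dekker_correct_of_estimate` — the
  two-product hypotheses discharged for the FMA two-product, and for Dekker's TWO-PRODUCT with
  `predicates.c`'s splitter (`p ≤ 2s ≤ p + 1`, rounding odd, `e₀ ≥ emin + p − 1`,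
  `2e₀ ≥ emin + 2p − 1`).
* The coefficient is representable: `isFloat_o3derrboundB32` (`Orient3dStageBMargins.lean`;
  `p ≥ 7`, `emin ≤ 5 − 2p`), so `K ⊗ permanent` is the product the C code forms.

WHAT THIS DOES NOT SAY.  The `estimate` bound is assumed, not proved, in THIS file (see above).
Nothing about stage A having failed is used (the statement holds whenever
the stage-B test passes); nothing is claimed about `predicates.c` with ITS constant `(3 + 28ε)ε`
(our margin does not certify it with the estimate error `3ε` available to us — recorded in
`Orient3dStageBMargins.lean`, not adjudicated); stages C–D of ORIENT3D are not treated; INCIRCLE's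
stage B is the sibling chain `IncircleStageBExpansion.lean` / `IncircleStageBBounds.lean`.
HONEST CAVEATS: overflow is not modelled; for binary64 (`p = 53`, `emin = −1074`) the format
hypothesis `emin + 2p ≤ 3e₀` means coordinates that are multiples of `2^−322` (e.g. any doubles of
magnitude at least `2^−270`), not arbitrary doubles.

No separate numerical evidence was gathered for this file (it composes proved statements; the
ingredients came with their own evidence: exhaustive `estimate` searches at `p ≤ 6`, sampled
stage-B margins, the expansion lemmas' tests).

References: J. R. Shewchuk, Discrete Comput. Geom. 18 (1997) 305–363, §4.4 (Table 3, Fig. 22) and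
`predicates.c` (`orient3d`, `orient3dadapt`) [Shewchuk1997].
-/

namespace Summit.Ventures.CertifiedArithmetic.Expansions

open Literature.ComputerArithmetic.JeannerodRump2018
open Literature.ComputerArithmetic.BoldoJeannerodMelquiondMuller2023 hiding twoSum twoSum_fst
  isFloat_twoSum
open Literature.ComputerArithmetic.Shewchuk1997

variable {p : ℕ} {emin : ℤ} {fl : ℚ → ℚ}

/-! ## The model of stage B -/

/-- The `permanent` of ORIENT3D's stage A (Fig. 22; `predicates.c` `orient3d`), passed on to
`orient3dadapt`: `(|bdxcdy| ⊕ |cdxbdy|) ⊗ |adz| ⊕ (|cdxady| ⊕ |adxcdy|) ⊗ |bdz|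
⊕ (|adxbdy| ⊕ |bdxady|) ⊗ |cdz|` (left to right) — literally the expression inside
`orient3dStageA`. -/
def orient3dPermanent (fl : ℚ → ℚ) (a₁ a₂ a₃ b₁ b₂ b₃ c₁ c₂ c₃ d₁ d₂ d₃ : ℚ) : ℚ :=
  let adx := fl (a₁ - d₁)
  let bdx := fl (b₁ - d₁)
  let cdx := fl (c₁ - d₁)
  let ady := fl (a₂ - d₂)
  let bdy := fl (b₂ - d₂)
  let cdy := fl (c₂ - d₂)
  let adz := fl (a₃ - d₃)
  let bdz := fl (b₃ - d₃)
  let cdz := fl (c₃ - d₃)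
  let bdxcdy := fl (bdx * cdy)
  let cdxbdy := fl (cdx * bdy)
  let cdxady := fl (cdx * ady)
  let adxcdy := fl (adx * cdy)
  let adxbdy := fl (adx * bdy)
  let bdxady := fl (bdx * ady)
  fl (fl (fl (fl (|bdxcdy| + |cdxbdy|) * |adz|) + fl (fl (|cdxady| + |adxcdy|) * |bdz|))
    + fl (fl (|adxbdy| + |bdxady|) * |cdz|))

/-- **Stage B of `orient3dadapt`** over a two-product `tp`, a rounding `fl`, a coefficient `K` and
the inherited `permanent`: `fin1 ⇐ orient3dB(adx, ady, adz, bdx, …, cdz)` (the exact expansion of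
the determinant of the computed differences), `det ⇐ estimate(fin1)`,
`errbound ⇐ K ⊗ permanent`; return `det` iff `det ≥ errbound` or `−det ≥ errbound`.  `some det` =
stage B answers; `none` = fall through to stage C. -/
def orient3dStageB (tp : ℚ → ℚ → ℚ × ℚ) (fl : ℚ → ℚ) (K permanent : ℚ)
    (a₁ a₂ a₃ b₁ b₂ b₃ c₁ c₂ c₃ d₁ d₂ d₃ : ℚ) : Option ℚ :=
  let det := estimate fl (orient3dB tp fl (fl (a₁ - d₁)) (fl (a₂ - d₂)) (fl (a₃ - d₃))
    (fl (b₁ - d₁)) (fl (b₂ - d₂)) (fl (b₃ - d₃)) (fl (c₁ - d₁)) (fl (c₂ - d₂)) (fl (c₃ - d₃)))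
  if fl (K * permanent) ≤ det ∨ fl (K * permanent) ≤ -det then some det else none

/-! ## The stage-B test is sound -/

/-- **THE STAGE-B TEST OF `orient3dadapt` IS SOUND with `K = (3 + 32ε)ε`, given the `estimate`
bound.**  Let `p ≥ 7`, `fl` any round-to-nearest into `F(p, emin)` with the `RoundoffBelow 2`
property (e.g. ties-to-even) whose `estimate` is `3ε`-accurate on W-expansions of floats (`hest3`,
the conclusion of `abs_estimate_sub_sum_le_of_isWeakExpansion`), the twelve coordinates floats of
a format `F(p, e₀)` with `emin ≤ e₀` and `emin + 2p ≤ 3e₀`, and the two-product routine error-free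
on `F(p, e₀)²` and on `F(p, 2e₀) × F(p, e₀)`.  If stage B, run with `K = o3derrboundB32 p` and the
permanent of stage A, returns `d`, then `d > 0 ↔ (7) > 0` and `d < 0 ↔ (7) < 0` for the exact
determinant `orient3dDet`; in particular `d ≠ 0` and the returned sign is the true orientation. -/
theorem orient3dStageB_correct_of_estimate (hp : 7 ≤ p) (hfl : IsRoundNearest p emin fl)
    (hfl2 : RoundoffBelow 2 fl)
    (hest3 : ∀ ⦃l : List ℚ⦄, (∀ x ∈ l, IsFloat p emin x) → IsWeakExpansion l →
      |estimate fl l - l.sum| ≤ 3 * unitRoundoff p * |l.sum|)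
    {e₀ : ℤ} (he₀ : emin ≤ e₀) (h3 : emin + 2 * p ≤ e₀ + e₀ + e₀)
    {a₁ a₂ a₃ b₁ b₂ b₃ c₁ c₂ c₃ d₁ d₂ d₃ : ℚ}
    (ha₁ : IsFloat p e₀ a₁) (ha₂ : IsFloat p e₀ a₂) (ha₃ : IsFloat p e₀ a₃)
    (hb₁ : IsFloat p e₀ b₁) (hb₂ : IsFloat p e₀ b₂) (hb₃ : IsFloat p e₀ b₃)
    (hc₁ : IsFloat p e₀ c₁) (hc₂ : IsFloat p e₀ c₂) (hc₃ : IsFloat p e₀ c₃)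
    (hd₁ : IsFloat p e₀ d₁) (hd₂ : IsFloat p e₀ d₂) (hd₃ : IsFloat p e₀ d₃)
    {tp : ℚ → ℚ → ℚ × ℚ}
    (htp : ∀ x y, IsFloat p e₀ x → IsFloat p e₀ y → ExactTwoProd p emin fl tp x y)
    (htp' : ∀ x y, IsFloat p (e₀ + e₀) x → IsFloat p e₀ y → ExactTwoProd p emin fl tp x y)
    {d : ℚ}
    (hB : orient3dStageB tp fl (o3derrboundB32 p)
      (orient3dPermanent fl a₁ a₂ a₃ b₁ b₂ b₃ c₁ c₂ c₃ d₁ d₂ d₃)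
      a₁ a₂ a₃ b₁ b₂ b₃ c₁ c₂ c₃ d₁ d₂ d₃ = some d) :
    (0 < d ↔ 0 < orient3dDet a₁ a₂ a₃ b₁ b₂ b₃ c₁ c₂ c₃ d₁ d₂ d₃) ∧
      (d < 0 ↔ orient3dDet a₁ a₂ a₃ b₁ b₂ b₃ c₁ c₂ c₃ d₁ d₂ d₃ < 0) := by
  have hp1 : 1 ≤ p := le_trans (by norm_num) hp
  have hp4 : 4 ≤ p := le_trans (by norm_num) hp
  have he₂ : emin ≤ e₀ + e₀ := by omega
  have he₃ : emin ≤ e₀ + e₀ + e₀ := by omega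
  have he₄ : emin ≤ -(2 * (p : ℤ)) + (e₀ + e₀ + e₀) := by omega
  have hu0 : 0 < unitRoundoff p := by unfold unitRoundoff; positivity
  have hu128 : unitRoundoff p ≤ 1 / 128 := unitRoundoff_le_of_seven_le hp
  have hu2 : unitRoundoff p ≤ 1 / 2 := by linarith
  have hδ0 : (0 : ℚ) ≤ 3 * unitRoundoff p := by positivity
  have hδ1 : 3 * unitRoundoff p < 1 := by linarith
  have hmargin : (1 + 3 * unitRoundoff p) * (3 * unitRoundoff p + 6 * unitRoundoff p ^ 2
      + 4 * unitRoundoff p ^ 3 + unitRoundoff p ^ 4)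
      < (1 - unitRoundoff p) ^ 5 * o3derrboundB32 p :=
    o3derrboundB32_margin hu0 hu128
  -- grids: the nine differences (`2^e₀ ℤ`) and their roundings, which are floats of `F(p, e₀)`
  have gta₁ := (OnGrid.of_isFloat ha₁).sub (OnGrid.of_isFloat hd₁)
  have gta₂ := (OnGrid.of_isFloat ha₂).sub (OnGrid.of_isFloat hd₂)
  have gta₃ := (OnGrid.of_isFloat ha₃).sub (OnGrid.of_isFloat hd₃)
  have gtb₁ := (OnGrid.of_isFloat hb₁).sub (OnGrid.of_isFloat hd₁)
  have gtb₂ := (OnGrid.of_isFloat hb₂).sub (OnGrid.of_isFloat hd₂)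
  have gtb₃ := (OnGrid.of_isFloat hb₃).sub (OnGrid.of_isFloat hd₃)
  have gtc₁ := (OnGrid.of_isFloat hc₁).sub (OnGrid.of_isFloat hd₁)
  have gtc₂ := (OnGrid.of_isFloat hc₂).sub (OnGrid.of_isFloat hd₂)
  have gtc₃ := (OnGrid.of_isFloat hc₃).sub (OnGrid.of_isFloat hd₃)
  have gxa₁ := gta₁.fl_of hp1 hfl he₀
  have gxa₂ := gta₂.fl_of hp1 hfl he₀
  have gxa₃ := gta₃.fl_of hp1 hfl he₀
  have gxb₁ := gtb₁.fl_of hp1 hfl he₀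
  have gxb₂ := gtb₂.fl_of hp1 hfl he₀
  have gxb₃ := gtb₃.fl_of hp1 hfl he₀
  have gxc₁ := gtc₁.fl_of hp1 hfl he₀
  have gxc₂ := gtc₂.fl_of hp1 hfl he₀
  have gxc₃ := gtc₃.fl_of hp1 hfl he₀
  have fxa₁ : IsFloat p e₀ (fl (a₁ - d₁)) := isFloat_of_isFloat_of_onGrid (hfl _).1 gxa₁
  have fxa₂ : IsFloat p e₀ (fl (a₂ - d₂)) := isFloat_of_isFloat_of_onGrid (hfl _).1 gxa₂
  have fxa₃ : IsFloat p e₀ (fl (a₃ - d₃)) := isFloat_of_isFloat_of_onGrid (hfl _).1 gxa₃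
  have fxb₁ : IsFloat p e₀ (fl (b₁ - d₁)) := isFloat_of_isFloat_of_onGrid (hfl _).1 gxb₁
  have fxb₂ : IsFloat p e₀ (fl (b₂ - d₂)) := isFloat_of_isFloat_of_onGrid (hfl _).1 gxb₂
  have fxb₃ : IsFloat p e₀ (fl (b₃ - d₃)) := isFloat_of_isFloat_of_onGrid (hfl _).1 gxb₃
  have fxc₁ : IsFloat p e₀ (fl (c₁ - d₁)) := isFloat_of_isFloat_of_onGrid (hfl _).1 gxc₁
  have fxc₂ : IsFloat p e₀ (fl (c₂ - d₂)) := isFloat_of_isFloat_of_onGrid (hfl _).1 gxc₂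
  have fxc₃ : IsFloat p e₀ (fl (c₃ - d₃)) := isFloat_of_isFloat_of_onGrid (hfl _).1 gxc₃
  -- the six products and their roundings (`2^2e₀ ℤ`)
  have gp₁ := gxb₁.mul gxc₂
  have gp₂ := gxc₁.mul gxb₂
  have gp₃ := gxc₁.mul gxa₂
  have gp₄ := gxa₁.mul gxc₂
  have gp₅ := gxa₁.mul gxb₂
  have gp₆ := gxb₁.mul gxa₂
  have gP₁ := gp₁.fl_of hp1 hfl he₂
  have gP₂ := gp₂.fl_of hp1 hfl he₂
  have gP₃ := gp₃.fl_of hp1 hfl he₂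
  have gP₄ := gp₄.fl_of hp1 hfl he₂
  have gP₅ := gp₅.fl_of hp1 hfl he₂
  have gP₆ := gp₆.fl_of hp1 hfl he₂
  -- the permanent chain: `A_a = fl(|P₁| + |P₂|)` (`2^2e₀ ℤ`), `α_a = fl(A_a |adz|)`, `W₁`, `W`
  -- (`2^3e₀ ℤ`), `errbound = fl(K W)` (`2^(3e₀ − 2p) ℤ`)
  have gsa := gP₁.abs.add gP₂.abs
  have gsb := gP₃.abs.add gP₄.abs
  have gsc := gP₅.abs.add gP₆.abs
  have gAa := gsa.fl_of hp1 hfl he₂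
  have gAb := gsb.fl_of hp1 hfl he₂
  have gAc := gsc.fl_of hp1 hfl he₂
  have gala := gAa.mul gxa₃.abs
  have galb := gAb.mul gxb₃.abs
  have galc := gAc.mul gxc₃.abs
  have gαa := gala.fl_of hp1 hfl he₃
  have gαb := galb.fl_of hp1 hfl he₃
  have gαc := galc.fl_of hp1 hfl he₃
  have gw₁ := gαa.add gαb
  have gW₁ := gw₁.fl_of hp1 hfl he₃
  have gw := gW₁.add gαc
  have gW := gw.fl_of hp1 hfl he₃
  have ge := (onGrid_o3derrboundB32 p).mul gW
  -- the expansion `fin1` is a W-expansion of floats with sum `B`; `det = estimate fin1 = B ± 3εB`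
  obtain ⟨hW, hS, hF, -, -, -⟩ :=
    orient3dB_spec hp4 hfl hfl2 he₂ he₃ htp htp' fxa₁ fxa₂ fxa₃ fxb₁ fxb₂ fxb₃ fxc₁ fxc₂ fxc₃
  have hest := hest3 hF hW
  rw [hS] at hest
  unfold orient3dDetB at hest
  -- the branches of stage B
  unfold orient3dStageB at hB
  simp only [] at hB
  split_ifs at hB with htest
  obtain rfl := Option.some.inj hB
  simp only [orient3dPermanent] at htest
  unfold orient3dDet
  obtain ⟨⟨hBT₁, hBT₂⟩, ⟨hBd₁, hBd₂⟩⟩ := orient3d_stageB_sign_of_bounds hu0 hu2 hδ0 hδ1 hmargin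
    (abs_sub_fl_le_eps_mul_abs_fl hp1 hfl he₀ gta₁) (abs_sub_fl_le_eps_mul_abs_fl hp1 hfl he₀ gta₂)
    (abs_sub_fl_le_eps_mul_abs_fl hp1 hfl he₀ gta₃) (abs_sub_fl_le_eps_mul_abs_fl hp1 hfl he₀ gtb₁)
    (abs_sub_fl_le_eps_mul_abs_fl hp1 hfl he₀ gtb₂) (abs_sub_fl_le_eps_mul_abs_fl hp1 hfl he₀ gtb₃)
    (abs_sub_fl_le_eps_mul_abs_fl hp1 hfl he₀ gtc₁) (abs_sub_fl_le_eps_mul_abs_fl hp1 hfl he₀ gtc₂)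
    (abs_sub_fl_le_eps_mul_abs_fl hp1 hfl he₀ gtc₃)
    (abs_sub_fl_le_eps_mul_abs_fl hp1 hfl he₂ gp₁) (abs_sub_fl_le_eps_mul_abs_fl hp1 hfl he₂ gp₂)
    (abs_sub_fl_le_eps_mul_abs_fl hp1 hfl he₂ gp₃) (abs_sub_fl_le_eps_mul_abs_fl hp1 hfl he₂ gp₄)
    (abs_sub_fl_le_eps_mul_abs_fl hp1 hfl he₂ gp₅) (abs_sub_fl_le_eps_mul_abs_fl hp1 hfl he₂ gp₆)
    (abs_sub_fl_le_eps_mul_abs hp1 hfl he₂ gsa) (abs_sub_fl_le_eps_mul_abs hp1 hfl he₂ gsb)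
    (abs_sub_fl_le_eps_mul_abs hp1 hfl he₂ gsc)
    (abs_sub_fl_le_eps_mul_abs hp1 hfl he₃ gala) (abs_sub_fl_le_eps_mul_abs hp1 hfl he₃ galb)
    (abs_sub_fl_le_eps_mul_abs hp1 hfl he₃ galc)
    (abs_sub_fl_le_eps_mul_abs hp1 hfl he₃ gw₁) (abs_sub_fl_le_eps_mul_abs hp1 hfl he₃ gw)
    (abs_sub_fl_le_eps_mul_abs hp1 hfl he₄ ge) hest
    (htest.elim (fun h => le_trans h (le_abs_self _)) (fun h => le_trans h (neg_le_abs _)))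
  exact ⟨hBd₁.symm.trans hBT₁, hBd₂.symm.trans hBT₂⟩

/-! ## Instances: FMA two-product; Dekker two-product -/

/-- **Stage B with the FMA two-product** (`2Prod_FMA`), given the `estimate` bound: sound for
`p ≥ 7`, any `RoundoffBelow 2` round-to-nearest, coordinates in `F(p, e₀)` with `emin ≤ e₀`,
`emin + 2p ≤ 3e₀`. -/
theorem orient3dStageB_fma_correct_of_estimate (hp : 7 ≤ p) (hfl : IsRoundNearest p emin fl)
    (hfl2 : RoundoffBelow 2 fl)
    (hest3 : ∀ ⦃l : List ℚ⦄, (∀ x ∈ l, IsFloat p emin x) → IsWeakExpansion l →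
      |estimate fl l - l.sum| ≤ 3 * unitRoundoff p * |l.sum|)
    {e₀ : ℤ} (he₀ : emin ≤ e₀) (h3 : emin + 2 * p ≤ e₀ + e₀ + e₀)
    {a₁ a₂ a₃ b₁ b₂ b₃ c₁ c₂ c₃ d₁ d₂ d₃ : ℚ}
    (ha₁ : IsFloat p e₀ a₁) (ha₂ : IsFloat p e₀ a₂) (ha₃ : IsFloat p e₀ a₃)
    (hb₁ : IsFloat p e₀ b₁) (hb₂ : IsFloat p e₀ b₂) (hb₃ : IsFloat p e₀ b₃)
    (hc₁ : IsFloat p e₀ c₁) (hc₂ : IsFloat p e₀ c₂) (hc₃ : IsFloat p e₀ c₃)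
    (hd₁ : IsFloat p e₀ d₁) (hd₂ : IsFloat p e₀ d₂) (hd₃ : IsFloat p e₀ d₃) {d : ℚ}
    (hB : orient3dStageB (twoProdFMA fl) fl (o3derrboundB32 p)
      (orient3dPermanent fl a₁ a₂ a₃ b₁ b₂ b₃ c₁ c₂ c₃ d₁ d₂ d₃)
      a₁ a₂ a₃ b₁ b₂ b₃ c₁ c₂ c₃ d₁ d₂ d₃ = some d) :
    (0 < d ↔ 0 < orient3dDet a₁ a₂ a₃ b₁ b₂ b₃ c₁ c₂ c₃ d₁ d₂ d₃) ∧
      (d < 0 ↔ orient3dDet a₁ a₂ a₃ b₁ b₂ b₃ c₁ c₂ c₃ d₁ d₂ d₃ < 0) := by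
  have hp1 : 1 ≤ p := le_trans (by norm_num) hp
  have he₂ : emin ≤ e₀ + e₀ := by omega
  have he₃ : emin ≤ e₀ + e₀ + e₀ := by omega
  exact orient3dStageB_correct_of_estimate hp hfl hfl2 hest3 he₀ h3 ha₁ ha₂ ha₃ hb₁ hb₂ hb₃ hc₁
    hc₂ hc₃ hd₁ hd₂ hd₃ (fun x y hx hy => exactTwoProd_twoProdFMA₂ hp1 hfl he₂ hx hy)
    (fun x y hx hy => exactTwoProd_twoProdFMA₂ hp1 hfl he₃ hx hy) hB

/-- **Stage B with Shewchuk's TWO-PRODUCT** (Dekker, split point `s`, `p ≤ 2s ≤ p + 1`, rounding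
odd and `RoundoffBelow 2` — ties-to-even qualifies), given the `estimate` bound: sound for `p ≥ 7`
and coordinates in `F(p, e₀)` with `e₀ ≥ emin + p − 1`, `2e₀ ≥ emin + 2p − 1`, `3e₀ ≥ emin + 2p`
(Theorem 18's no-underflow regime for the two-products, plus stage A's grids). -/
theorem orient3dStageB_dekker_correct_of_estimate (hp : 7 ≤ p) {s : ℕ} (hs2 : p ≤ 2 * s)
    (hs2' : 2 * s ≤ p + 1) (hfl : IsRoundNearest p emin fl) (hodd : ∀ t, fl (-t) = -fl t)
    (hfl2 : RoundoffBelow 2 fl)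
    (hest3 : ∀ ⦃l : List ℚ⦄, (∀ x ∈ l, IsFloat p emin x) → IsWeakExpansion l →
      |estimate fl l - l.sum| ≤ 3 * unitRoundoff p * |l.sum|)
    {e₀ : ℤ} (h1 : emin + p - 1 ≤ e₀)
    (h2 : emin + 2 * p - 1 ≤ e₀ + e₀) (h3 : emin + 2 * p ≤ e₀ + e₀ + e₀)
    {a₁ a₂ a₃ b₁ b₂ b₃ c₁ c₂ c₃ d₁ d₂ d₃ : ℚ}
    (ha₁ : IsFloat p e₀ a₁) (ha₂ : IsFloat p e₀ a₂) (ha₃ : IsFloat p e₀ a₃)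
    (hb₁ : IsFloat p e₀ b₁) (hb₂ : IsFloat p e₀ b₂) (hb₃ : IsFloat p e₀ b₃)
    (hc₁ : IsFloat p e₀ c₁) (hc₂ : IsFloat p e₀ c₂) (hc₃ : IsFloat p e₀ c₃)
    (hd₁ : IsFloat p e₀ d₁) (hd₂ : IsFloat p e₀ d₂) (hd₃ : IsFloat p e₀ d₃) {d : ℚ}
    (hB : orient3dStageB (twoProduct fl s) fl (o3derrboundB32 p)
      (orient3dPermanent fl a₁ a₂ a₃ b₁ b₂ b₃ c₁ c₂ c₃ d₁ d₂ d₃)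
      a₁ a₂ a₃ b₁ b₂ b₃ c₁ c₂ c₃ d₁ d₂ d₃ = some d) :
    (0 < d ↔ 0 < orient3dDet a₁ a₂ a₃ b₁ b₂ b₃ c₁ c₂ c₃ d₁ d₂ d₃) ∧
      (d < 0 ↔ orient3dDet a₁ a₂ a₃ b₁ b₂ b₃ c₁ c₂ c₃ d₁ d₂ d₃ < 0) := by
  have hp4 : 4 ≤ p := le_trans (by norm_num) hp
  have he₀ : emin ≤ e₀ := by omega
  exact orient3dStageB_correct_of_estimate hp hfl hfl2 hest3 he₀ h3 ha₁ ha₂ ha₃ hb₁ hb₂ hb₃ hc₁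
    hc₂ hc₃ hd₁ hd₂ hd₃
    (fun x y hx hy => exactTwoProd_twoProduct₂ hp4 hs2 hs2' hfl hodd h1 h1 h2 hx hy)
    (fun x y hx hy => exactTwoProd_twoProduct₂ hp4 hs2 hs2' hfl hodd (by omega) h1 (by omega) hx hy)
    hB

/-- The inherited value is the one stage A computes: `orient3dStageA` and `orient3dStageB` read
the same `permanent` (definitional). -/
theorem orient3dStageA_eq (fl : ℚ → ℚ) (K : ℚ) (a₁ a₂ a₃ b₁ b₂ b₃ c₁ c₂ c₃ d₁ d₂ d₃ : ℚ) :
    orient3dStageA fl K a₁ a₂ a₃ b₁ b₂ b₃ c₁ c₂ c₃ d₁ d₂ d₃ =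
      (let det := fl (fl (fl (fl (a₃ - d₃) * fl (fl (fl (b₁ - d₁) * fl (c₂ - d₂))
          - fl (fl (c₁ - d₁) * fl (b₂ - d₂)))) + fl (fl (b₃ - d₃) * fl (fl (fl (c₁ - d₁)
          * fl (a₂ - d₂)) - fl (fl (a₁ - d₁) * fl (c₂ - d₂))))) + fl (fl (c₃ - d₃)
          * fl (fl (fl (a₁ - d₁) * fl (b₂ - d₂)) - fl (fl (b₁ - d₁) * fl (a₂ - d₂)))))
        let errbound := fl (K * orient3dPermanent fl a₁ a₂ a₃ b₁ b₂ b₃ c₁ c₂ c₃ d₁ d₂ d₃)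
        if errbound < det ∨ errbound < -det then some det else none) := rfl

end Summit.Ventures.CertifiedArithmetic.Expansions
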